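import Literature.NumberTheory.Automorphic.UnitaryGroupArthurTraceBorelRefined
import Literature.NumberTheory.Automorphic.UnitaryGroupCharpolyBorelClasses
import HarnessLib

/-!
# The three LAW 5 sockets: `J(f) = Σ_{elliptic} Σ' vol·Φ + Σ_{central} p_𝔬(0) + Σ_{singular} p_𝔬(0) + Σ_{hyperbolic} p_𝔬(0)`
# on the quasi-split `U(J₃)` of a CM field

(Rogawski, *Automorphic Representations of Unitary Groups in Three Variables* (1990), §2.2–§2.3 pp. 13–14, §3.4–§3.6
pp. 23–27 (central, singular `d(a,b,a)`, regular elements of the maximal torus), §7.2–§7.3 (the singular and unipotent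
terms); Arthur, *A trace formula for reductive groups I*, Duke Math. J. 45 (1978), §8.)

Topic `NumberTheory/Automorphic`; namespace `Literature.NumberTheory.Automorphic.UnitaryGroup`. THEOREMS ONLY (no definition,
no instance, no named fact, no notation, no `sorry`). Row (L5-σ) «THE THREE SOCKETS» of the T1-qs road of
`Cruxes/H413/Lines/F0_T1InnerFormTraceIdentity.lean` (cell `pub/hodgecm-mathlib`, crux H413; LAW sub-lead word 11:04:33Z).

WHY. ★ `arthurTrace_eq_sum_orbital_add_sum_borelRefined_cm` (`UnitaryGroupArthurTraceBorelRefined`, the LAW 5 socket of record)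
writes Arthur's `J(f)` for the Borel-refined class map `cl♭ = (charpoly ∘ adelicVal, flag)` as the elliptic orbital sum over the
refined classes missing `B(L⁺)` plus `Σ_{i ∈ S♭_f, i meets B(L⁺)} p_i(0)`. The classes meeting `B(L⁺)` are exactly the `(j, true)`
with `j = ((X − a)(X − b)(X − (c a)⁻¹)).map`, `a ∈ Lˣ`, `b ∈ L¹` (★ `forall_arithmeticBorel_borelRefine_ne_iff`, ★
`not_forall_arithmeticBorel_charpoly_ne_iff`), and by the trichotomy ★ `meetsBorel_trichotomy` with its exclusions ★
`not_central_and_singular` ∕ `not_central_and_hyperbolic` ∕ `not_singular_and_hyperbolic` that second sum splits into THREE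
literal summands — (σ-i) CENTRAL × unipotent `j = ((X − z)³).map`, `z ∈ L¹` (the unipotent term, Rogawski Prop. 7.3.2); (σ-ii)
SINGULAR `j = ((X − a)²(X − b)).map`, `a ≠ b ∈ L¹` (centraliser `U(1,1) × U(1)`, Props 7.2.1–7.2.2); (σ-iii) REGULAR HYPERBOLIC
`j = ((X − a)(X − b)(X − (c a)⁻¹)).map`, `c a · a ≠ 1` (the weighted orbital integrals, Arthur 1978 §8, Rogawski Ch. 6) — so
that each of the three LAW 5 rows closes a literal summand of a ★ statement (`obtain`ing its `z` ∕ `(a, b)` from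
`Finset.mem_filter`).

* `not_forall_arithmeticBorel_borelRefine_charpoly_ne_iff` — «`i` meets `B(L⁺)`» ⟺ `i.2 = true ∧ ∃ a b, …` (the index reading);
* **`arthurTrace_eq_sum_orbital_add_sum_central_add_sum_singular_add_sum_hyperbolic_cm`** — ★ C §3 with its second sum split:
  `J(f) = Σ_{S♭_f.filter (∀ β, cl♭ β ≠ i)}.attach c_μ Σ' vol·Φ + (Σ_{S♭_f.filter central} p_i(0) + Σ_{S♭_f.filter singular} p_i(0)
  + Σ_{S♭_f.filter hyperbolic} p_i(0))` for every `T`, same `P`, same live set `S♭_f`, NO hypothesis beyond the letters.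

## References

* J. D. Rogawski, *Automorphic Representations of Unitary Groups in Three Variables*, Ann. of Math. Stud. 123 (1990), §2.2–§2.3
  (pp. 13–14), §3.4–§3.6 (pp. 23–27), §7.2–§7.3 (pp. 91–97) [Rogawski1990].
* J. Arthur, *A trace formula for reductive groups I*, Duke Math. J. 45 (1978), §8 [Arthur1978TraceFormulaI].
-/

set_option autoImplicit false

noncomputable section

open MeasureTheory Measure NumberField NumberField.mixedEmbedding IsDedekindDomain Set Polynomial Topology
open Literature.MeasureTheory.Group
open scoped NNReal ENNReal Pointwise MatrixGroups Classical

namespace Literature.NumberTheory.Automorphic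

namespace UnitaryGroup

/-! ## §1 Bookkeeping: a three-way split of a filtered sum; the classes meeting `B(L⁺)` -/

/-- A three-way split of a filtered finite sum: if `Q`-elements are exactly the disjoint union of the `P₁`-, `P₂`- and
`P₃`-elements, then `∑_{Q} g = ∑_{P₁} g + ∑_{P₂} g + ∑_{P₃} g`. [folklore] -/
private theorem sum_filter_eq_sum_filter_add_sum_filter_add_sum_filter {ι M : Type*} [AddCommMonoid M] (S : Finset ι)
    (Q P₁ P₂ P₃ : ι → Prop) [DecidablePred Q] [DecidablePred P₁] [DecidablePred P₂] [DecidablePred P₃] (g : ι → M)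
    (h₁ : ∀ i, P₁ i → Q i) (h₂ : ∀ i, P₂ i → Q i) (h₃ : ∀ i, P₃ i → Q i) (hQ : ∀ i, Q i → P₁ i ∨ P₂ i ∨ P₃ i)
    (h₁₂ : ∀ i, P₁ i → P₂ i → False) (h₁₃ : ∀ i, P₁ i → P₃ i → False) (h₂₃ : ∀ i, P₂ i → P₃ i → False) :
    ∑ i ∈ S.filter Q, g i = ∑ i ∈ S.filter P₁, g i + ∑ i ∈ S.filter P₂, g i + ∑ i ∈ S.filter P₃, g i := by
  classical
  rw [← Finset.sum_filter_add_sum_filter_not (S.filter Q) P₁, Finset.filter_filter, Finset.filter_filter,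
    ← Finset.sum_filter_add_sum_filter_not ((S.filter fun i => Q i ∧ ¬ P₁ i)) P₂, Finset.filter_filter,
    Finset.filter_filter, add_assoc]
  congr 1
  · exact Finset.sum_congr (Finset.filter_congr fun i _ => ⟨fun h => h.2, fun h => ⟨h₁ i h, h⟩⟩) fun _ _ => rfl
  congr 1
  · exact Finset.sum_congr (Finset.filter_congr fun i _ =>
      ⟨fun h => h.2, fun h => ⟨⟨h₂ i h, fun h1 => h₁₂ i h1 h⟩, h⟩⟩) fun _ _ => rfl
  · exact Finset.sum_congr (Finset.filter_congr fun i _ =>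
      ⟨fun h => by
        rcases hQ i h.1.1 with hp | hp | hp
        · exact (h.1.2 hp).elim
        · exact (h.2 hp).elim
        · exact hp,
       fun h => ⟨⟨h₃ i h, fun h1 => h₁₃ i h1 h⟩, fun h2 => h₂₃ i h2 h⟩⟩) fun _ _ => rfl

/-- **THE CLASSES MEETING `B(L⁺)` FOR THE REFINED MAP `cl♭ = (charpoly ∘ adelicVal, flag)`** (`U(J₃)` over a CM field):
the NEGATION of the `B(L⁺)`-missing filter predicate of ★ `arthurTrace_eq_sum_orbital_add_sum_borelRefined_cm` at `i = (j, flag)`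
holds iff `flag = true` AND `j = ((X − a)(X − b)(X − (c a)⁻¹)).map (L → 𝔸_L)` for some `a ∈ Lˣ`, `b ∈ L¹` (★
`forall_arithmeticBorel_borelRefine_ne_iff` + ★ `not_forall_arithmeticBorel_charpoly_ne_iff`) — the index set of the LAW 5
sockets. [cite: Rogawski1990, §2.2–2.3 (pp. 13–14)] [cite: Arthur1978TraceFormulaI, §8] -/
theorem not_forall_arithmeticBorel_borelRefine_charpoly_ne_iff (L : Type) [Field L] [NumberField L] [IsCMField L]
    (i : (AdeleRing (𝓞 L) L)[X] × Bool) :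
    (¬ ∀ β : ↥(arithmeticBorel (↥(maximalRealSubfield L)) L (IsCMField.complexConj L) 3),
            (((adelicVal (↥(maximalRealSubfield L)) L (IsCMField.complexConj L) 3 _ ((β : ↥(quasiSplit (↥(maximalRealSubfield L)) L (IsCMField.complexConj L) 3).arithmeticSubgroup) : (quasiSplit (↥(maximalRealSubfield L)) L (IsCMField.complexConj L) 3).Adelic) :
                GL (Fin 3) (AdeleRing (𝓞 L) L)) : Matrix (Fin 3) (Fin 3) (AdeleRing (𝓞 L) L)).charpoly,
              decide (∃ δ : ↥(quasiSplit (↥(maximalRealSubfield L)) L (IsCMField.complexConj L) 3).arithmeticSubgroup, δ * (β : ↥(quasiSplit (↥(maximalRealSubfield L)) L (IsCMField.complexConj L) 3).arithmeticSubgroup) * δ⁻¹ ∈ arithmeticBorel (↥(maximalRealSubfield L)) L (IsCMField.complexConj L) 3)) ≠ i) ↔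
    i.2 = true ∧ ∃ a b : Lˣ, (IsCMField.complexConj L) (b : L) * (b : L) = 1 ∧
      i.1 = ((X - C (a : L)) * (X - C (b : L)) * (X - C ((IsCMField.complexConj L) (a : L))⁻¹)).map (algebraMap L (AdeleRing (𝓞 L) L)) := by
  have h := forall_arithmeticBorel_borelRefine_ne_iff (F := ↥(maximalRealSubfield L)) (E := L) (c := IsCMField.complexConj L)
    (N := 3)
    (fun γ : ↥(quasiSplit (↥(maximalRealSubfield L)) L (IsCMField.complexConj L) 3).arithmeticSubgroup =>
      ((adelicVal (↥(maximalRealSubfield L)) L (IsCMField.complexConj L) 3 _ (γ : (quasiSplit (↥(maximalRealSubfield L)) L (IsCMField.complexConj L) 3).Adelic) :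
          GL (Fin 3) (AdeleRing (𝓞 L) L)) : Matrix (Fin 3) (Fin 3) (AdeleRing (𝓞 L) L)).charpoly) i
  rw [← not_forall_arithmeticBorel_charpoly_ne_iff (F := ↥(maximalRealSubfield L)) (complexConj_mul_complexConj L) i.1]
  constructor
  · intro hn
    refine ⟨?_, fun hall => hn (h.2 (Or.inr hall))⟩
    cases hb : i.2
    · exact absurd (h.2 (Or.inl hb)) hn
    · rfl
  · rintro ⟨hi2, hex⟩ hall
    rcases h.1 hall with h2 | h2
    · rw [hi2] at h2; exact Bool.noConfusion h2
    · exact hex h2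

/-! ## §2 The three sockets -/

/-- **`J(f) = Σ_{elliptic} c_μ Σ' vol · Φ + Σ_{central} p_i(0) + Σ_{singular} p_i(0) + Σ_{regular hyperbolic} p_i(0)`** on the
quasi-split `U(J₃)` of a CM extension `L/L⁺`, for the Borel-refined characteristic-polynomial class map `cl♭` and EVERY `T`:
★ `arthurTrace_eq_sum_orbital_add_sum_borelRefined_cm` (same class polynomials `P`, same live set `S♭_f`, same four bookkeeping
conjuncts) with its second sum — the refined classes MEETING `B(L⁺)` — split along the trichotomy ★ `meetsBorel_trichotomy` into the
three pairwise disjoint filters (σ-i) `i.2 = true ∧ i.1 = ((X − z)³).map`, `z ∈ L¹` (central × unipotent: the unipotent term),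
(σ-ii) `i.2 = true ∧ i.1 = ((X − a)²(X − b)).map`, `a ≠ b ∈ L¹` (singular, centraliser `U(1,1) × U(1)`), (σ-iii) `i.2 = true ∧
i.1 = ((X − a)(X − b)(X − (c a)⁻¹)).map`, `c a · a ≠ 1` (regular hyperbolic: weighted orbital integrals). NO hypothesis beyond the
letters. [cite: Rogawski1990, §2.2–2.3 (pp. 13–14); §3.4–3.6 (pp. 23–27)] [cite: Arthur1978TraceFormulaI, §8] -/
theorem arthurTrace_eq_sum_orbital_add_sum_central_add_sum_singular_add_sum_hyperbolic_cm (L : Type) [Field L] [NumberField L] [IsCMField L]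
    [instMA : MeasurableSpace (quasiSplit (↥(maximalRealSubfield L)) L (IsCMField.complexConj L) 3).Adelic] [instBA : BorelSpace (quasiSplit (↥(maximalRealSubfield L)) L (IsCMField.complexConj L) 3).Adelic]
    (ν : Measure (quasiSplit (↥(maximalRealSubfield L)) L (IsCMField.complexConj L) 3).Adelic) [instν : IsHaarMeasure ν]
    (μ : Measure (quasiSplit (↥(maximalRealSubfield L)) L (IsCMField.complexConj L) 3).automorphicQuotient)
    [instμ : (quasiSplit (↥(maximalRealSubfield L)) L (IsCMField.complexConj L) 3).IsAutomorphicMeasure μ]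
    [instMU : MeasurableSpace (adelicUnipotent (↥(maximalRealSubfield L)) L (IsCMField.complexConj L) 3)]
    [instBU : BorelSpace (adelicUnipotent (↥(maximalRealSubfield L)) L (IsCMField.complexConj L) 3)]
    [instMQ : ∀ γ : (quasiSplit (↥(maximalRealSubfield L)) L (IsCMField.complexConj L) 3).Adelic,
      MeasurableSpace ((quasiSplit (↥(maximalRealSubfield L)) L (IsCMField.complexConj L) 3).Adelic ⧸
        Subgroup.centralizer ({γ} : Set (quasiSplit (↥(maximalRealSubfield L)) L (IsCMField.complexConj L) 3).Adelic))]
    [instBQ : ∀ γ : (quasiSplit (↥(maximalRealSubfield L)) L (IsCMField.complexConj L) 3).Adelic,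
      BorelSpace ((quasiSplit (↥(maximalRealSubfield L)) L (IsCMField.complexConj L) 3).Adelic ⧸
        Subgroup.centralizer ({γ} : Set (quasiSplit (↥(maximalRealSubfield L)) L (IsCMField.complexConj L) 3).Adelic))]
    [instMS : ∀ γ : (quasiSplit (↥(maximalRealSubfield L)) L (IsCMField.complexConj L) 3).Adelic,
      MeasurableSpace (↥(Subgroup.centralizer ({γ} : Set (quasiSplit (↥(maximalRealSubfield L)) L (IsCMField.complexConj L) 3).Adelic)) ⧸
        ((quasiSplit (↥(maximalRealSubfield L)) L (IsCMField.complexConj L) 3).quotientSubgroup ⊓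
          Subgroup.centralizer ({γ} : Set (quasiSplit (↥(maximalRealSubfield L)) L (IsCMField.complexConj L) 3).Adelic)).subgroupOf
          (Subgroup.centralizer ({γ} : Set (quasiSplit (↥(maximalRealSubfield L)) L (IsCMField.complexConj L) 3).Adelic)))]
    [instBS : ∀ γ : (quasiSplit (↥(maximalRealSubfield L)) L (IsCMField.complexConj L) 3).Adelic,
      BorelSpace (↥(Subgroup.centralizer ({γ} : Set (quasiSplit (↥(maximalRealSubfield L)) L (IsCMField.complexConj L) 3).Adelic)) ⧸
        ((quasiSplit (↥(maximalRealSubfield L)) L (IsCMField.complexConj L) 3).quotientSubgroup ⊓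
          Subgroup.centralizer ({γ} : Set (quasiSplit (↥(maximalRealSubfield L)) L (IsCMField.complexConj L) 3).Adelic)).subgroupOf
          (Subgroup.centralizer ({γ} : Set (quasiSplit (↥(maximalRealSubfield L)) L (IsCMField.complexConj L) 3).Adelic)))]
    (ν₀ : Measure (adelicUnipotent (↥(maximalRealSubfield L)) L (IsCMField.complexConj L) 3)) [instν₀ : ν₀.IsHaarMeasure]
    (𝓕 : Set (adelicUnipotent (↥(maximalRealSubfield L)) L (IsCMField.complexConj L) 3))
    (h𝓕 : IsFundamentalDomain (rationalUnipotent (↥(maximalRealSubfield L)) L (IsCMField.complexConj L) 3) 𝓕 ν₀)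
    (rep : ConjClasses ↥(quasiSplit (↥(maximalRealSubfield L)) L (IsCMField.complexConj L) 3).arithmeticSubgroup → ↥(quasiSplit (↥(maximalRealSubfield L)) L (IsCMField.complexConj L) 3).arithmeticSubgroup)
    (hrep : ∀ s, ConjClasses.mk (rep s) = s)
    (νC : ∀ s : ConjClasses ↥(quasiSplit (↥(maximalRealSubfield L)) L (IsCMField.complexConj L) 3).arithmeticSubgroup,
      Measure ↥(Subgroup.centralizer ({((rep s : ↥(quasiSplit (↥(maximalRealSubfield L)) L (IsCMField.complexConj L) 3).arithmeticSubgroup) : (quasiSplit (↥(maximalRealSubfield L)) L (IsCMField.complexConj L) 3).Adelic)} : Set (quasiSplit (↥(maximalRealSubfield L)) L (IsCMField.complexConj L) 3).Adelic)))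
    [instνC : ∀ s, IsHaarMeasure (νC s)]
    (f : (quasiSplit (↥(maximalRealSubfield L)) L (IsCMField.complexConj L) 3).Adelic → ℂ)
    (hf : IsQuasiSplitTest (↥(maximalRealSubfield L)) L (IsCMField.complexConj L) 3 f) :
    haveI := t2Space_quasiSplitAdelic (F := ↥(maximalRealSubfield L)) (E := L) (c := IsCMField.complexConj L) (N := 3)
    haveI := locallyCompactSpace_quasiSplitAdelic (F := ↥(maximalRealSubfield L)) (E := L) (c := IsCMField.complexConj L) (N := 3)
    haveI := secondCountableTopology_quasiSplitAdelic (F := ↥(maximalRealSubfield L)) (E := L) (c := IsCMField.complexConj L) (N := 3)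
    haveI : IsClosed (((quasiSplit (↥(maximalRealSubfield L)) L (IsCMField.complexConj L) 3).quotientSubgroup : Set (quasiSplit (↥(maximalRealSubfield L)) L (IsCMField.complexConj L) 3).Adelic)) :=
      isClosed_quotientSubgroup_quasiSplit
    haveI : ∀ γ : (quasiSplit (↥(maximalRealSubfield L)) L (IsCMField.complexConj L) 3).Adelic, IsClosed ((Subgroup.centralizer ({γ} : Set (quasiSplit (↥(maximalRealSubfield L)) L (IsCMField.complexConj L) 3).Adelic) :
        Subgroup (quasiSplit (↥(maximalRealSubfield L)) L (IsCMField.complexConj L) 3).Adelic) : Set (quasiSplit (↥(maximalRealSubfield L)) L (IsCMField.complexConj L) 3).Adelic) := isClosed_centralizer_quasiSplit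
    haveI : ∀ γ : (quasiSplit (↥(maximalRealSubfield L)) L (IsCMField.complexConj L) 3).Adelic, (count : Measure ↥(((quasiSplit (↥(maximalRealSubfield L)) L (IsCMField.complexConj L) 3).quotientSubgroup ⊓
        Subgroup.centralizer ({γ} : Set (quasiSplit (↥(maximalRealSubfield L)) L (IsCMField.complexConj L) 3).Adelic)).subgroupOf
          (Subgroup.centralizer ({γ} : Set (quasiSplit (↥(maximalRealSubfield L)) L (IsCMField.complexConj L) 3).Adelic)))).IsHaarMeasure :=
      isHaarMeasure_count_inf_centralizer_subgroupOf_quasiSplit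
    haveI : (count : Measure (quasiSplit (↥(maximalRealSubfield L)) L (IsCMField.complexConj L) 3).quotientSubgroup).IsHaarMeasure :=
      isHaarMeasure_count_quotientSubgroup_quasiSplit
    haveI : ν.IsMulRightInvariant := isMulRightInvariant_quasiSplit_cm_three L ν
    letI := AdelicGroupData.measurableSpaceQuotientForm (quasiSplit (↥(maximalRealSubfield L)) L (IsCMField.complexConj L) 3)
    haveI := AdelicGroupData.borelSpaceQuotientForm (quasiSplit (↥(maximalRealSubfield L)) L (IsCMField.complexConj L) 3)
    haveI := AdelicGroupData.smulInvariantMeasureQuotientForm (quasiSplit (↥(maximalRealSubfield L)) L (IsCMField.complexConj L) 3) μ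
    haveI := AdelicGroupData.isFiniteMeasureOnCompactsQuotientForm (quasiSplit (↥(maximalRealSubfield L)) L (IsCMField.complexConj L) 3) μ
    ∃ P : (AdeleRing (𝓞 L) L)[X] × Bool → ℂ[X],
      (∀ i, (P i).natDegree ≤ 1) ∧
      (∀ i ∈ (finite_setOf_borelRefine_charpoly_of_isCompact (F := ↥(maximalRealSubfield L)) (E := L) (c := IsCMField.complexConj L) (N := 3)
          hf.hasCompactSupport'.isCompact).toFinset,
        ∃ T₀ : ℝ≥0, ∀ T : ℝ≥0, T₀ < T →
        truncatedTraceClass μ ν₀ 𝓕 T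
          (fun γ : ↥(quasiSplit (↥(maximalRealSubfield L)) L (IsCMField.complexConj L) 3).arithmeticSubgroup =>
            (((adelicVal (↥(maximalRealSubfield L)) L (IsCMField.complexConj L) 3 _ (γ : (quasiSplit (↥(maximalRealSubfield L)) L (IsCMField.complexConj L) 3).Adelic) :
                GL (Fin 3) (AdeleRing (𝓞 L) L)) : Matrix (Fin 3) (Fin 3) (AdeleRing (𝓞 L) L)).charpoly,
              decide (∃ δ : ↥(quasiSplit (↥(maximalRealSubfield L)) L (IsCMField.complexConj L) 3).arithmeticSubgroup, δ * γ * δ⁻¹ ∈ arithmeticBorel (↥(maximalRealSubfield L)) L (IsCMField.complexConj L) 3))) i f = (P i).eval ((Real.log (T : ℝ) : ℝ) : ℂ)) ∧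
      truncatedTracePolynomial μ ν₀ 𝓕 f =
        ∑ i ∈ (finite_setOf_borelRefine_charpoly_of_isCompact (F := ↥(maximalRealSubfield L)) (E := L) (c := IsCMField.complexConj L) (N := 3)
          hf.hasCompactSupport'.isCompact).toFinset, P i ∧
      (∀ i ∈ (finite_setOf_borelRefine_charpoly_of_isCompact (F := ↥(maximalRealSubfield L)) (E := L) (c := IsCMField.complexConj L) (N := 3)
          hf.hasCompactSupport'.isCompact).toFinset,
        (∀ β : ↥(arithmeticBorel (↥(maximalRealSubfield L)) L (IsCMField.complexConj L) 3),
          (((adelicVal (↥(maximalRealSubfield L)) L (IsCMField.complexConj L) 3 _ ((β : ↥(quasiSplit (↥(maximalRealSubfield L)) L (IsCMField.complexConj L) 3).arithmeticSubgroup) : (quasiSplit (↥(maximalRealSubfield L)) L (IsCMField.complexConj L) 3).Adelic) :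
                GL (Fin 3) (AdeleRing (𝓞 L) L)) : Matrix (Fin 3) (Fin 3) (AdeleRing (𝓞 L) L)).charpoly,
              decide (∃ δ : ↥(quasiSplit (↥(maximalRealSubfield L)) L (IsCMField.complexConj L) 3).arithmeticSubgroup, δ * (β : ↥(quasiSplit (↥(maximalRealSubfield L)) L (IsCMField.complexConj L) 3).arithmeticSubgroup) * δ⁻¹ ∈ arithmeticBorel (↥(maximalRealSubfield L)) L (IsCMField.complexConj L) 3)) ≠ i) →
        ∀ T : ℝ≥0, P i = C (truncatedTraceClass μ ν₀ 𝓕 T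
          (fun γ : ↥(quasiSplit (↥(maximalRealSubfield L)) L (IsCMField.complexConj L) 3).arithmeticSubgroup =>
            (((adelicVal (↥(maximalRealSubfield L)) L (IsCMField.complexConj L) 3 _ (γ : (quasiSplit (↥(maximalRealSubfield L)) L (IsCMField.complexConj L) 3).Adelic) :
                GL (Fin 3) (AdeleRing (𝓞 L) L)) : Matrix (Fin 3) (Fin 3) (AdeleRing (𝓞 L) L)).charpoly,
              decide (∃ δ : ↥(quasiSplit (↥(maximalRealSubfield L)) L (IsCMField.complexConj L) 3).arithmeticSubgroup, δ * γ * δ⁻¹ ∈ arithmeticBorel (↥(maximalRealSubfield L)) L (IsCMField.complexConj L) 3))) i f)) ∧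
      ∀ T : ℝ≥0, arthurTrace μ ν₀ 𝓕 f =
        (∑ i ∈ (((finite_setOf_borelRefine_charpoly_of_isCompact (F := ↥(maximalRealSubfield L)) (E := L) (c := IsCMField.complexConj L) (N := 3)
          hf.hasCompactSupport'.isCompact).toFinset).filter (fun i => ∀ β : ↥(arithmeticBorel (↥(maximalRealSubfield L)) L (IsCMField.complexConj L) 3),
            (((adelicVal (↥(maximalRealSubfield L)) L (IsCMField.complexConj L) 3 _ ((β : ↥(quasiSplit (↥(maximalRealSubfield L)) L (IsCMField.complexConj L) 3).arithmeticSubgroup) : (quasiSplit (↥(maximalRealSubfield L)) L (IsCMField.complexConj L) 3).Adelic) :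
                GL (Fin 3) (AdeleRing (𝓞 L) L)) : Matrix (Fin 3) (Fin 3) (AdeleRing (𝓞 L) L)).charpoly,
              decide (∃ δ : ↥(quasiSplit (↥(maximalRealSubfield L)) L (IsCMField.complexConj L) 3).arithmeticSubgroup, δ * (β : ↥(quasiSplit (↥(maximalRealSubfield L)) L (IsCMField.complexConj L) 3).arithmeticSubgroup) * δ⁻¹ ∈ arithmeticBorel (↥(maximalRealSubfield L)) L (IsCMField.complexConj L) 3)) ≠ i)).attach,
          ((unfoldingConstant (quasiSplit (↥(maximalRealSubfield L)) L (IsCMField.complexConj L) 3).quotientSubgroup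
              (count : Measure (quasiSplit (↥(maximalRealSubfield L)) L (IsCMField.complexConj L) 3).quotientSubgroup) μ ν : ℝ) : ℂ) *
            ∑' s : {s : ConjClasses ↥(quasiSplit (↥(maximalRealSubfield L)) L (IsCMField.complexConj L) 3).arithmeticSubgroup //
                (((adelicVal (↥(maximalRealSubfield L)) L (IsCMField.complexConj L) 3 _ ((rep s : ↥(quasiSplit (↥(maximalRealSubfield L)) L (IsCMField.complexConj L) 3).arithmeticSubgroup) : (quasiSplit (↥(maximalRealSubfield L)) L (IsCMField.complexConj L) 3).Adelic) :
                GL (Fin 3) (AdeleRing (𝓞 L) L)) : Matrix (Fin 3) (Fin 3) (AdeleRing (𝓞 L) L)).charpoly,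
              decide (∃ δ : ↥(quasiSplit (↥(maximalRealSubfield L)) L (IsCMField.complexConj L) 3).arithmeticSubgroup, δ * (rep s : ↥(quasiSplit (↥(maximalRealSubfield L)) L (IsCMField.complexConj L) 3).arithmeticSubgroup) * δ⁻¹ ∈ arithmeticBorel (↥(maximalRealSubfield L)) L (IsCMField.complexConj L) 3)) = i.1},
              (haveI : (νC s.1).IsMulRightInvariant :=
                  isMulRightInvariant_centralizer_of_forall_cl_ne (complexConj_mul_complexConj L)
                    (isConjInvariant_borelRefine isConjInvariant_charpoly_adelicVal) (Finset.mem_filter.1 i.2).2 s.2 (νC s.1);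
                haveI : (νC s.1).IsInvInvariant :=
                  isInvInvariant_centralizer_of_forall_cl_ne (complexConj_mul_complexConj L)
                    (isConjInvariant_borelRefine isConjInvariant_charpoly_adelicVal) (Finset.mem_filter.1 i.2).2 s.2 (νC s.1);
                ((quotientMeasure (((quasiSplit (↥(maximalRealSubfield L)) L (IsCMField.complexConj L) 3).quotientSubgroup ⊓
                    Subgroup.centralizer ({((rep s.1 : ↥(quasiSplit (↥(maximalRealSubfield L)) L (IsCMField.complexConj L) 3).arithmeticSubgroup) : (quasiSplit (↥(maximalRealSubfield L)) L (IsCMField.complexConj L) 3).Adelic)} : Set (quasiSplit (↥(maximalRealSubfield L)) L (IsCMField.complexConj L) 3).Adelic)).subgroupOf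
                    (Subgroup.centralizer ({((rep s.1 : ↥(quasiSplit (↥(maximalRealSubfield L)) L (IsCMField.complexConj L) 3).arithmeticSubgroup) : (quasiSplit (↥(maximalRealSubfield L)) L (IsCMField.complexConj L) 3).Adelic)} : Set (quasiSplit (↥(maximalRealSubfield L)) L (IsCMField.complexConj L) 3).Adelic)))
                    count (isClosed_inf_centralizer_subgroupOf_quasiSplit _) (νC s.1) Set.univ).toReal : ℂ) *
                  orbitalIntegral ((rep s.1 : ↥(quasiSplit (↥(maximalRealSubfield L)) L (IsCMField.complexConj L) 3).arithmeticSubgroup) : (quasiSplit (↥(maximalRealSubfield L)) L (IsCMField.complexConj L) 3).Adelic) f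
                    (quotientMeasure (Subgroup.centralizer ({((rep s.1 : ↥(quasiSplit (↥(maximalRealSubfield L)) L (IsCMField.complexConj L) 3).arithmeticSubgroup) : (quasiSplit (↥(maximalRealSubfield L)) L (IsCMField.complexConj L) 3).Adelic)} : Set (quasiSplit (↥(maximalRealSubfield L)) L (IsCMField.complexConj L) 3).Adelic)) (νC s.1)
                      (isClosed_centralizer_quasiSplit _) ν))) +
        ((∑ i ∈ ((finite_setOf_borelRefine_charpoly_of_isCompact (F := ↥(maximalRealSubfield L)) (E := L) (c := IsCMField.complexConj L) (N := 3)
          hf.hasCompactSupport'.isCompact).toFinset).filter (fun i : (AdeleRing (𝓞 L) L)[X] × Bool => i.2 = true ∧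
            ∃ z : Lˣ, (IsCMField.complexConj L) (z : L) * (z : L) = 1 ∧
              i.1 = ((X - C (z : L)) ^ 3).map (algebraMap L (AdeleRing (𝓞 L) L))),
            (P i).eval 0) +
          (∑ i ∈ ((finite_setOf_borelRefine_charpoly_of_isCompact (F := ↥(maximalRealSubfield L)) (E := L) (c := IsCMField.complexConj L) (N := 3)
          hf.hasCompactSupport'.isCompact).toFinset).filter (fun i : (AdeleRing (𝓞 L) L)[X] × Bool => i.2 = true ∧
            ∃ a b : Lˣ, (IsCMField.complexConj L) (a : L) * (a : L) = 1 ∧ (IsCMField.complexConj L) (b : L) * (b : L) = 1 ∧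
              (a : L) ≠ (b : L) ∧ i.1 = ((X - C (a : L)) ^ 2 * (X - C (b : L))).map (algebraMap L (AdeleRing (𝓞 L) L))),
            (P i).eval 0) +
          (∑ i ∈ ((finite_setOf_borelRefine_charpoly_of_isCompact (F := ↥(maximalRealSubfield L)) (E := L) (c := IsCMField.complexConj L) (N := 3)
          hf.hasCompactSupport'.isCompact).toFinset).filter (fun i : (AdeleRing (𝓞 L) L)[X] × Bool => i.2 = true ∧
            ∃ a b : Lˣ, (IsCMField.complexConj L) (a : L) * (a : L) ≠ 1 ∧ (IsCMField.complexConj L) (b : L) * (b : L) = 1 ∧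
              i.1 = ((X - C (a : L)) * (X - C (b : L)) * (X - C ((IsCMField.complexConj L) (a : L))⁻¹)).map (algebraMap L (AdeleRing (𝓞 L) L))),
            (P i).eval 0)) := by
  have hC3 := @arthurTrace_eq_sum_orbital_add_sum_borelRefined_cm L _ _ _ instMA instBA μ instμ ν instν instMU instBU instMQ instBQ
    instMS instBS ν₀ instν₀ 𝓕 h𝓕 rep hrep νC instνC f hf
  obtain ⟨P, hdeg, hP, hpoly, hC, hJ⟩ := hC3
  refine ⟨P, hdeg, hP, hpoly, hC, fun T => (hJ T).trans ?_⟩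
  congr 1
  refine sum_filter_eq_sum_filter_add_sum_filter_add_sum_filter _ _ _ _ _ (fun i => (P i).eval 0)
    (fun i hi => ?_) (fun i hi => ?_) (fun i hi => ?_) (fun i hi => ?_)
    (fun i h₁ h₂ => not_central_and_singular (F := ↥(maximalRealSubfield L)) h₁.2 h₂.2)
    (fun i h₁ h₃ => not_central_and_hyperbolic (F := ↥(maximalRealSubfield L)) (complexConj_mul_complexConj L) h₁.2 h₃.2)
    (fun i h₂ h₃ => not_singular_and_hyperbolic (F := ↥(maximalRealSubfield L)) (complexConj_mul_complexConj L) h₂.2 h₃.2)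
  · -- central ⇒ meets `B(L⁺)` with flag `true`
    obtain ⟨hi2, z, hz, hi1⟩ := hi
    refine (not_forall_arithmeticBorel_borelRefine_charpoly_ne_iff L i).2 ⟨hi2, z, z, hz, ?_⟩
    rw [hi1, (eq_inv_of_mul_eq_one_right hz).symm]
    ring_nf
  · obtain ⟨hi2, a, b, ha, hb, -, hi1⟩ := hi
    refine (not_forall_arithmeticBorel_borelRefine_charpoly_ne_iff L i).2 ⟨hi2, a, b, hb, ?_⟩
    rw [hi1, (eq_inv_of_mul_eq_one_right ha).symm]
    ring_nf
  · obtain ⟨hi2, a, b, -, hb, hi1⟩ := hi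
    exact (not_forall_arithmeticBorel_borelRefine_charpoly_ne_iff L i).2 ⟨hi2, a, b, hb, hi1⟩
  · obtain ⟨hi2, hab⟩ := (not_forall_arithmeticBorel_borelRefine_charpoly_ne_iff L i).1 hi
    rcases meetsBorel_trichotomy (F := ↥(maximalRealSubfield L)) hab with h | h | h
    · exact Or.inl ⟨hi2, h⟩
    · exact Or.inr (Or.inl ⟨hi2, h⟩)
    · exact Or.inr (Or.inr ⟨hi2, h⟩)

end UnitaryGroup

end Literature.NumberTheory.Automorphic
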